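import Literature.MathematicalPhysics.QuantumFieldTheory.PlaquetteSystemTwistAgreement
import Literature.Probability.LatticeModels.ClusterExpansionKPBound
import HarnessLib

/-!
# Two families with the same small-polymer activities, WITH RATE: `|ln Z₁ - ln Z₂| ≤ 2·#P·e^{-τA}` under `(Δ+1)² e^{1+τ} ε ≤ 1/2`

Topic `Literature/MathematicalPhysics/QuantumFieldTheory`; sequel of `PlaquetteSystemTwistAgreement.lean` (the case `τ = 1`).  THEOREMS ONLY.
Kotecký–Preiss with the size functions `a(X) = |X|`, `d(X) = τ|X|` ([KP86] Theorem p. 492 with (1), (4)): the smallness `(Δ+1)² e^{1+τ} ε ≤ 1/2`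
buys the tail `e^{-τA}` for clusters containing a polymer with `≥ A` plaquettes; choosing `e^{-τ} = 2(Δ+1)² e ε` this is the RATE
`(c ε)^A` of E. T. Tomboulis, arXiv:0707.2179 [Tomboulis2007Confinement] (6.12) and K. R. Ito, E. Seiler [ItoSeiler2008Further] Thm 2.2 (1)
(the tree's symmetric-torus `CentralTwist.abs_log_twistZ_sub_log_twistZ_le_pow`), for an arbitrary finite plaquette–link system:

* `kpTerm_le_kpWeight_rate`, `kp_hypothesis_polymerActivity_rate(_tsum)`, `kpSmall_of_rate` — KP (1) with `d = τ|·|`;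
* `sum_norm_truncatedWeight_le_of_large_rate` — the tail `#P · e^{-τA}`;
* ★ `abs_log_Z_sub_log_Z_le_of_agree_rate` — `|ln Z₁ - ln Z₂| ≤ 2·#P·e^{-τA}` (`τ ≥ 1`).

HONEST FRAMING: finite-volume bounds; no limit.  Instance: `AnisotropicTwistedPartitionFunctionStrongCouplingRate.lean`.
-/

noncomputable section

open MeasureTheory Finset
open scoped BigOperators
open Literature.Probability.LatticeModels

namespace Literature.MathematicalPhysics.QuantumFieldTheory

namespace PlaquetteSystem

variable {P E G : Type*} (S : PlaquetteSystem P E G)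
variable [Fintype E] [DecidableEq E] [Group G] [TopologicalSpace G] [IsTopologicalGroup G] [CompactSpace G]
  [MeasurableSpace G] [BorelSpace G] [Fintype P] [DecidableEq P]

/-! ### Kotecký–Preiss smallness with a rate: `a = |·|`, `d = τ|·|` -/

omit [DecidableEq E] [Fintype P] [DecidableEq P] in
/-- `‖z_w(X)‖ e^{(1+τ)|X|} ≤ μ(X)` with `μ` the geometric weight `(e^{1+τ} ε)^{|X|}` on polymers. [cite: KoteckyPreiss1986, Theorem p. 492, hypothesis (1)] -/
theorem kpTerm_le_kpWeight_rate {w : P → G → ℝ} {ε : ℝ} (hε : ∀ p W, |w p W - 1| ≤ ε) (τ : ℝ) (X : Finset P) :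
    ‖S.polymerActivity w X‖ * Real.exp ((X.card : ℝ) + τ * X.card) ≤ kpWeight S.linkRel (Real.exp (1 + τ) * ε) X := by
  unfold kpWeight
  split_ifs with hX
  · rw [mul_pow, ← Real.exp_nat_mul, mul_comm (Real.exp _)]
    have h2 : ((X.card : ℝ) + τ * X.card) = (X.card : ℝ) * (1 + τ) := by ring
    rw [h2]
    exact mul_le_mul_of_nonneg_right (S.norm_polymerActivity_le hε X) (Real.exp_nonneg _)
  · rw [S.polymerActivity_of_not_isRConnected hX, norm_zero, zero_mul]

/-- **Kotecký–Preiss hypothesis (1) with `a(X) = |X|`, `d(X) = τ|X|`** under `(Δ+1)² e^{1+τ} ε ≤ 1/2`, `τ ≥ 0`.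
[cite: KoteckyPreiss1986, Theorem p. 492, hypothesis (1)] -/
theorem kp_hypothesis_polymerActivity_rate {Δ : ℕ} (hΔ : ∀ p, (S.nbrs p).card ≤ Δ) {w : P → G → ℝ} {ε : ℝ}
    (hε : ∀ p W, |w p W - 1| ≤ ε) {τ : ℝ} (hsmall : ((Δ : ℝ) + 1) ^ 2 * (Real.exp (1 + τ) * ε) ≤ 1 / 2) (γ : Finset P) :
    ∑ γ' ∈ Finset.univ with GeomInc S.linkRel γ' γ,
        ‖S.polymerActivity w γ'‖ * Real.exp ((γ'.card : ℝ) + τ * γ'.card) ≤ γ.card := by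
  rcases isEmpty_or_nonempty P with hP | ⟨⟨p₀⟩⟩
  · have h0 : ∀ γ' : Finset P, S.polymerActivity w γ' = 0 := fun γ' =>
      S.polymerActivity_of_not_isRConnected fun h => by
        obtain ⟨p, -⟩ := h.1
        exact hP.false p
    calc ∑ γ' ∈ Finset.univ with GeomInc S.linkRel γ' γ,
          ‖S.polymerActivity w γ'‖ * Real.exp ((γ'.card : ℝ) + τ * γ'.card) = 0 :=
          Finset.sum_eq_zero fun γ' _ => by rw [h0 γ', norm_zero, zero_mul]
      _ ≤ γ.card := Nat.cast_nonneg _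
  have hlam : 0 ≤ Real.exp (1 + τ) * ε := mul_nonneg (Real.exp_nonneg _) (eps_nonneg_of_bound hε p₀)
  have h1 := sum_kpWeight_le_of_touches (R := S.linkRel) (nbr := S.nbrs) (Δ := Δ) S.linkRel_symm
    hΔ (fun _ _ h => S.mem_nbrs.2 h) hlam hsmall γ (Finset.univ.filter fun γ' => GeomInc S.linkRel γ' γ)
    (fun Y hY => by
      rcases (Finset.mem_filter.1 hY).2 with h | h
      · exact Or.inl h
      · exact (geomInc_symm S.linkRel S.linkRel_symm (Or.inr h)).elim (fun h => Or.inl h.symm) Or.inr)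
  refine ((Finset.sum_le_sum fun γ' _ => S.kpTerm_le_kpWeight_rate hε τ γ').trans h1).trans ?_
  have hD : (1 : ℝ) ≤ (Δ : ℝ) + 1 := by
    have : (0 : ℝ) ≤ (Δ : ℝ) := Nat.cast_nonneg _
    linarith
  have hkey : ((Δ : ℝ) + 1) * (2 * (Real.exp (1 + τ) * ε)) ≤ 1 := by nlinarith
  calc (γ.card : ℝ) * ((Δ : ℝ) + 1) * (2 * (Real.exp (1 + τ) * ε))
      = (γ.card : ℝ) * (((Δ : ℝ) + 1) * (2 * (Real.exp (1 + τ) * ε))) := by ring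
    _ ≤ (γ.card : ℝ) * 1 := mul_le_mul_of_nonneg_left hkey (Nat.cast_nonneg _)
    _ = γ.card := mul_one _

/-- The rate KP hypothesis in the summable/`tsum` form. [cite: KoteckyPreiss1986, Theorem p. 492, hypothesis (1)] -/
theorem kp_hypothesis_polymerActivity_rate_tsum {Δ : ℕ} (hΔ : ∀ p, (S.nbrs p).card ≤ Δ) {w : P → G → ℝ} {ε : ℝ}
    (hε : ∀ p W, |w p W - 1| ≤ ε) {τ : ℝ} (hsmall : ((Δ : ℝ) + 1) ^ 2 * (Real.exp (1 + τ) * ε) ≤ 1 / 2) (γ : Finset P) :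
    Summable (fun γ' : {γ' : Finset P // GeomInc S.linkRel γ' γ} =>
        ‖S.polymerActivity w γ'‖ * Real.exp (((γ' : Finset P).card : ℝ) + τ * (γ' : Finset P).card)) ∧
      ∑' γ' : {γ' : Finset P // GeomInc S.linkRel γ' γ},
        ‖S.polymerActivity w γ'‖ * Real.exp (((γ' : Finset P).card : ℝ) + τ * (γ' : Finset P).card) ≤ γ.card :=
  kp_hypothesis_of_fintype (inc := GeomInc S.linkRel) (w := S.polymerActivity w)
    (a := fun X : Finset P => (X.card : ℝ)) (d := fun X : Finset P => τ * (X.card : ℝ))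
    (fun γ => S.kp_hypothesis_polymerActivity_rate hΔ hε hsmall γ) γ

omit [Fintype E] [DecidableEq E] [Group G] [TopologicalSpace G] [IsTopologicalGroup G] [CompactSpace G]
  [MeasurableSpace G] [BorelSpace G] [Fintype P] [DecidableEq P] in
/-- The rate smallness with `τ ≥ 1` implies the plain (`τ = 1`) Kotecký–Preiss smallness (plumbing). [cite: KoteckyPreiss1986, Theorem p. 492, hypothesis (1)] -/
theorem kpSmall_of_rate {Δ : ℕ} {ε τ : ℝ} (hε0 : 0 ≤ ε) (hτ : 1 ≤ τ)
    (hsmall : ((Δ : ℝ) + 1) ^ 2 * (Real.exp (1 + τ) * ε) ≤ 1 / 2) :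
    ((Δ : ℝ) + 1) ^ 2 * (Real.exp 2 * ε) ≤ 1 / 2 := by
  have h2 : Real.exp 2 ≤ Real.exp (1 + τ) := Real.exp_le_exp.2 (by linarith)
  have : ((Δ : ℝ) + 1) ^ 2 * (Real.exp 2 * ε) ≤ ((Δ : ℝ) + 1) ^ 2 * (Real.exp (1 + τ) * ε) :=
    mul_le_mul_of_nonneg_left (mul_le_mul_of_nonneg_right h2 hε0) (by positivity)
  linarith

/-- **The tail with a rate**: clusters containing a polymer with `≥ A` plaquettes weigh at most `#P · e^{-τA}` under the rate
smallness `(Δ+1)² e^{1+τ} ε ≤ 1/2`, `τ ≥ 0`. [cite: KoteckyPreiss1986, Theorem p. 492, estimate (4)] -/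
theorem sum_norm_truncatedWeight_le_of_large_rate {Δ : ℕ} (hΔ : ∀ p, (S.nbrs p).card ≤ Δ) {w : P → G → ℝ} {ε : ℝ}
    (hε : ∀ p W, |w p W - 1| ≤ ε) {τ : ℝ} (hτ : 0 ≤ τ)
    (hsmall : ((Δ : ℝ) + 1) ^ 2 * (Real.exp (1 + τ) * ε) ≤ 1 / 2) {A : ℕ}
    (𝒞 : Finset (Finset (Finset P))) (hlarge : ∀ C ∈ 𝒞, ∃ X ∈ C, X ∈ S.polymers ∧ A ≤ X.card) :
    ∑ C ∈ 𝒞, ‖truncatedWeight (GeomInc S.linkRel) (S.polymerActivity w) C‖ ≤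
      (Fintype.card P : ℝ) * Real.exp (-(τ * A)) := by
  classical
  haveI : Std.Refl (GeomInc S.linkRel) := ⟨geomInc_refl _⟩
  haveI : Std.Symm (GeomInc S.linkRel) := ⟨fun _ _ h => geomInc_symm _ S.linkRel_symm h⟩
  have hfact := koteckyPreiss_truncatedWeight_bound_holds (GeomInc S.linkRel) (S.polymerActivity w)
    (fun X : Finset P => (X.card : ℝ)) (fun X : Finset P => τ * (X.card : ℝ))
  have h1 := S.kp_hypothesis_polymerActivity_rate_tsum hΔ hε hsmall
  have hsize : ∀ C ∈ 𝒞, (τ * A : ℝ) ≤ ∑ γ' ∈ C, τ * ((γ'.card : ℕ) : ℝ) := by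
    intro C hC
    obtain ⟨X, hXC, -, hXA⟩ := hlarge C hC
    have h := Finset.single_le_sum (f := fun γ' : Finset P => τ * ((γ'.card : ℕ) : ℝ))
      (fun γ' _ => mul_nonneg hτ (Nat.cast_nonneg _)) hXC
    refine le_trans ?_ h
    exact mul_le_mul_of_nonneg_left (by exact_mod_cast hXA) hτ
  have hstep := fun p : P => sum_norm_truncatedWeight_le_exp_neg_of_touches hfact
    (fun _ => Nat.cast_nonneg _) (fun _ => mul_nonneg hτ (Nat.cast_nonneg _)) h1 𝒞 {p} (r := (τ * A : ℝ))
    (fun C hC _ => hsize C hC)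
  have hsum := Finset.sum_le_sum fun p (_ : p ∈ (Finset.univ : Finset P)) => hstep p
  -- covering bound: each cluster of `𝒞` touches `{p}` for some plaquette `p` of its large member
  have hcover : ∑ C ∈ 𝒞, ‖truncatedWeight (GeomInc S.linkRel) (S.polymerActivity w) C‖ ≤
      ∑ p ∈ (Finset.univ : Finset P), ∑ C ∈ 𝒞 with KPTouches (GeomInc S.linkRel) C {p},
        ‖truncatedWeight (GeomInc S.linkRel) (S.polymerActivity w) C‖ := by
    calc ∑ C ∈ 𝒞, ‖truncatedWeight (GeomInc S.linkRel) (S.polymerActivity w) C‖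
        ≤ ∑ C ∈ 𝒞, ∑ p ∈ (Finset.univ : Finset P) with KPTouches (GeomInc S.linkRel) C {p},
            ‖truncatedWeight (GeomInc S.linkRel) (S.polymerActivity w) C‖ := by
          refine Finset.sum_le_sum fun C hC => ?_
          obtain ⟨X, hXC, hXP, -⟩ := hlarge C hC
          obtain ⟨p, hp⟩ := S.nonempty_of_mem_polymers hXP
          rw [Finset.sum_const, nsmul_eq_mul]
          have htouch : KPTouches (GeomInc S.linkRel) C {p} :=
            ⟨X, hXC, Or.inr ⟨p, hp, p, Finset.mem_singleton_self p, Or.inl rfl⟩⟩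
          have h1 : (1 : ℝ) ≤ ((Finset.univ : Finset P).filter fun p => KPTouches (GeomInc S.linkRel) C {p}).card := by
            exact_mod_cast Finset.card_pos.2 ⟨p, Finset.mem_filter.2 ⟨Finset.mem_univ _, htouch⟩⟩
          nlinarith [norm_nonneg (truncatedWeight (GeomInc S.linkRel) (S.polymerActivity w) C)]
      _ = ∑ p ∈ (Finset.univ : Finset P), ∑ C ∈ 𝒞 with KPTouches (GeomInc S.linkRel) C {p},
            ‖truncatedWeight (GeomInc S.linkRel) (S.polymerActivity w) C‖ := by
          rw [Finset.sum_comm' (t' := Finset.univ) (s' := fun p => 𝒞.filter fun C => KPTouches (GeomInc S.linkRel) C {p})]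
          intro C p
          simp only [Finset.mem_filter, Finset.mem_univ, true_and]
          tauto
  refine (hcover.trans hsum).trans (le_of_eq ?_)
  simp only [Finset.card_singleton, Nat.cast_one, mul_one, Finset.sum_const, Finset.card_univ, nsmul_eq_mul]

/-- **★ Rate version of the two-family bound**: `|ln Z₁ - ln Z₂| ≤ 2 · #P · e^{-τA}` for two measurable families in the rate Kotecký–Preiss
region `(Δ+1)² e^{1+τ} ε ≤ 1/2` (`τ ≥ 1`) whose polymer activities agree on polymers with fewer than `A` plaquettes.  With
`e^{-τ} = 2(Δ+1)²e·ε` this is the rate `(c ε)^A` of arXiv:0707.2179 (6.12) / Ito–Seiler 2008 Thm 2.2 (1).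
[cite: Tomboulis2007Confinement, §6.2 eqs. (6.10)–(6.12)] [cite: KoteckyPreiss1986, Theorem p. 492, estimate (4)] -/
theorem abs_log_Z_sub_log_Z_le_of_agree_rate (hhol : ∀ p, Measurable fun U : E → G => S.hol U p) {Δ : ℕ}
    (hΔ : ∀ p, (S.nbrs p).card ≤ Δ) {w₁ w₂ : P → G → ℝ} (hw₁ : ∀ p, Measurable (w₁ p))
    (hw₂ : ∀ p, Measurable (w₂ p)) {ε : ℝ} (hε₁ : ∀ p W, |w₁ p W - 1| ≤ ε) (hε₂ : ∀ p W, |w₂ p W - 1| ≤ ε)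
    {τ : ℝ} (hτ : 1 ≤ τ) (hsmall : ((Δ : ℝ) + 1) ^ 2 * (Real.exp (1 + τ) * ε) ≤ 1 / 2) {A : ℕ}
    (hagree : ∀ X : Finset P, X.card < A → S.polymerActivity w₁ X = S.polymerActivity w₂ X) :
    |Real.log (S.Z w₁) - Real.log (S.Z w₂)| ≤ 2 * (Fintype.card P : ℝ) * Real.exp (-(τ * A)) := by
  classical
  rcases isEmpty_or_nonempty P with hP | ⟨⟨p₀⟩⟩
  · have hZ : ∀ w : P → G → ℝ, S.Z w = 1 := fun w => by
      unfold Z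
      have h : ∀ U : E → G, ∏ p : P, w p (S.hol U p) = 1 := fun U => Finset.prod_eq_one fun p _ => (hP.false p).elim
      simp_rw [h]
      rw [integral_const, smul_eq_mul, mul_one]
      simp
    rw [hZ, hZ, sub_self, abs_zero]
    positivity
  have hε0 : 0 ≤ ε := eps_nonneg_of_bound hε₁ p₀
  have hsmall1 := kpSmall_of_rate (Δ := Δ) hε0 hτ hsmall
  set ℓ₁ := polymerLogZ (GeomInc S.linkRel) (S.polymerActivity w₁) S.polymers with hℓ₁
  set ℓ₂ := polymerLogZ (GeomInc S.linkRel) (S.polymerActivity w₂) S.polymers with hℓ₂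
  have hlog₁ : Real.log (S.Z w₁) = ℓ₁.re := S.log_Z_eq_re_polymerLogZ hhol hΔ hw₁ hε₁ hsmall1
  have hlog₂ : Real.log (S.Z w₂) = ℓ₂.re := S.log_Z_eq_re_polymerLogZ hhol hΔ hw₂ hε₂ hsmall1
  have hl : ∀ C ∈ S.polymers.powerset.filter (fun C => (C ∩ S.polymers.filter fun X => A ≤ X.card).Nonempty),
      ∃ X ∈ C, X ∈ S.polymers ∧ A ≤ X.card := by
    intro C hC
    obtain ⟨X, hX⟩ := (Finset.mem_filter.1 hC).2
    rw [Finset.mem_inter, Finset.mem_filter] at hX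
    exact ⟨X, hX.1, hX.2.1, hX.2.2⟩
  have hτ0 : 0 ≤ τ := by linarith
  calc |Real.log (S.Z w₁) - Real.log (S.Z w₂)|
      = |(ℓ₁ - ℓ₂).re| := by rw [Complex.sub_re, hlog₁, hlog₂]
    _ ≤ ‖ℓ₁ - ℓ₂‖ := Complex.abs_re_le_norm _
    _ = ‖∑ C ∈ S.polymers.powerset with (C ∩ S.polymers.filter fun X => A ≤ X.card).Nonempty,
          (truncatedWeight (GeomInc S.linkRel) (S.polymerActivity w₁) C -
            truncatedWeight (GeomInc S.linkRel) (S.polymerActivity w₂) C)‖ := by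
        rw [hℓ₁, hℓ₂, S.polymerLogZ_sub_polymerLogZ_eq_of_agree hagree]
    _ ≤ ∑ C ∈ S.polymers.powerset with (C ∩ S.polymers.filter fun X => A ≤ X.card).Nonempty,
          (‖truncatedWeight (GeomInc S.linkRel) (S.polymerActivity w₁) C‖ +
            ‖truncatedWeight (GeomInc S.linkRel) (S.polymerActivity w₂) C‖) :=
        (norm_sum_le _ _).trans (Finset.sum_le_sum fun C _ => norm_sub_le _ _)
    _ ≤ (Fintype.card P : ℝ) * Real.exp (-(τ * A)) + (Fintype.card P : ℝ) * Real.exp (-(τ * A)) := by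
        rw [Finset.sum_add_distrib]
        exact add_le_add (S.sum_norm_truncatedWeight_le_of_large_rate hΔ hε₁ hτ0 hsmall _ hl)
          (S.sum_norm_truncatedWeight_le_of_large_rate hΔ hε₂ hτ0 hsmall _ hl)
    _ = 2 * (Fintype.card P : ℝ) * Real.exp (-(τ * A)) := by ring

end PlaquetteSystem

end Literature.MathematicalPhysics.QuantumFieldTheory

end
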